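import Summits.Langlands.Langlands.Theorems.CoreAdequacySplitNoAdequateLayerLiftingStubCoprimeTableLifting
import Summits.Langlands.Langlands.Theorems.CoreAdequacySplitNoAdequateLayerLiftingStubCoprimeTableLiftingBridgeConverse
import Summits.Langlands.Langlands.Theorems.ExtendedAdequacySplitKernel

/-!
# RSL `CoreAdequacySplit.NoAdequateLayerLifting` (stmt-Langlands-27954), line `birth`, stub 3/3 `stub_coprimeTableLifting` — STRUCTURAL HELPERS, part 5:
# the TABLE below the CURRENT LEAVES of the decomposition, and the landed INSTANCE PROFILE in one statement

* `stub_coprimeTableLifting_of_leaves` — the TABLE stub, VERBATIM, follows from the six current leaf cells below RSL: LIE and DSH of route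
  LieDefectSplit and HIGH, XS, CRD, CORE of route ExtendedAdequacySplit (landed kernels `LieDefect.rsl_of_cells'`, `ExtAdequacy.deg_of_cells`);
  `…_of_leaves_transport` replaces the bridge cell CRD by its landed transport T_N and the seven host/parent items it consumes
  (`ExtAdequacy.crd_of_transport`).  This is the exact list of OPEN items of record whose closure closes the stub.
* `table_instance_profile` — everything parts 1, 2, 4 prove about a single TABLE instance (`0 < n`, `ℓ < 2(n+1)`, `ℓ ∤ n`, `(n,ℓ) ≠ (2,3)`,
  `CycIrr ρ`, `¬ADQ`, `¬SADQ`), packaged: `2 ≤ n`; `n = 2 → ℓ = 5`; ¬SXADQ and no absolutely irreducible reduction with extended-adequate image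
  (the dials of ExtendedAdequacySplit, by the 2012 ⇄ 2017 bridge); and a finite absolutely irreducible reduction `τ` over `K(ζ_ℓ)` whose image has
  order divisible by `ℓ` and ALL of whose absolutely irreducible layers `J` above the perfect core have `ℓ ∣ |J|` and are adequate in NEITHER sense.
No new definition; 0 sorry.
-/

set_option linter.dupNamespace false

namespace Summit.Langlands.Langlands.Theorems.CoreAdequacy.CoprimeTable

open Filter
open scoped MatrixGroups
open Literature.NumberTheory.GaloisRepresentations
open Summit.Langlands.Langlands.Theses

/-! ## §1 The TABLE below the current leaves -/

/-- **TABLE ⟸ LIE ∧ DSH ∧ HIGH ∧ XS ∧ CRD ∧ CORE** — the six current leaf cells below RSL (routes LieDefectSplit and ExtendedAdequacySplit), composed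
through the landed kernels `ExtAdequacy.deg_of_cells` (HIGH ∧ XS ∧ CRD ∧ CORE ⟹ DEG) and `LieDefect.rsl_of_cells'` (LIE ∧ DEG ∧ DSH ⟹ RSL) and part 1's
row specialisation.  The conclusion is the stub's registered signature VERBATIM. -/
theorem stub_coprimeTableLifting_of_leaves (hL : LieDefect.LieObstructedLifting) (hB : LieDefect.DescentShadowLifting)
    (hH : ExtAdequacy.GenericPrimeDegenerateLifting) (hX : ExtAdequacy.ExtendedAdequateLayerLifting)
    (hCRD : ExtAdequacy.CoreReducibleDegenerateLifting) (hC : ExtAdequacy.CoreIrreducibleInadequateLifting) :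
    ∀ (K : Type) [Field K] [NumberField K] (n : ℕ) (hcpt : Literature.NumberTheory.Automorphic.isCompact_glFiniteIntegralLevel n K), 0 < n → (∀ m : ℕ, m < n → ∀ (K : Type) [Field K] [NumberField K] (hcpt : Literature.NumberTheory.Automorphic.isCompact_glFiniteIntegralLevel m K), 0 < m → ∀ (ℓ : ℕ) [Fact ℓ.Prime] (ι : PadicAlgCl ℓ ≃+* ℂ) (ρ : Literature.NumberTheory.GaloisRepresentations.FramedGaloisRep K (PadicAlgCl ℓ) m), ρ.toGaloisRep.IsIrreducible → ((∀ᶠ v : IsDedekindDomain.HeightOneSpectrum (NumberField.RingOfIntegers K) in cofinite, ρ.IsUnramifiedAt v) ∧ ∀ (v : IsDedekindDomain.HeightOneSpectrum (NumberField.RingOfIntegers K)) (hv : ((ℓ : ℕ) : NumberField.RingOfIntegers K) ∈ v.asIdeal), (Literature.NumberTheory.PAdicHodge.fontainePstAdicCompletion v ℓ hv).IsDeRhamFramed (ρ.toLocal v)) → (∃ (π : Literature.NumberTheory.Automorphic.CuspidalAutomorphicRepData m K hcpt) (ρ' : Literature.NumberTheory.GaloisRepresentations.FramedGaloisRep K (PadicAlgCl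 ℓ) m), π.1.IsLAlgebraic ∧ ρ'.toGaloisRep.IsIrreducible ∧ (∀ᶠ v : IsDedekindDomain.HeightOneSpectrum (NumberField.RingOfIntegers K) in cofinite, SatakeFrobCompatibleAt ι π.1 ρ' v) ∧ ∀ᶠ v : IsDedekindDomain.HeightOneSpectrum (NumberField.RingOfIntegers K) in cofinite, ∃ P P' : Polynomial (Valued.v : Valuation (PadicAlgCl ℓ) NNReal).valuationSubring, ρ.HasFrobCharpolyAt v (P.map (Valued.v : Valuation (PadicAlgCl ℓ) NNReal).valuationSubring.subtype) ∧ ρ'.HasFrobCharpolyAt v (P'.map (Valued.v : Valuation (PadicAlgCl ℓ) NNReal).valuationSubring.subtype) ∧ P.map (IsLocalRing.residue (Valued.v : Valuation (PadicAlgCl ℓ) NNReal).valuationSubring) = P'.map (IsLocalRing.residue (Valued.v : Valuation (PadicAlgCl ℓ) NNReal).valuationSubring)) → ∃ π : Literature.NumberTheory.Automorphic.CuspidalAutomorphicRepData m K hcpt, π.1.IsLAlgebraic ∧ ∀ᶠ v : IsDedekindDomain.HeightOneSpectrum (NumberField.RingOfIntegers K) in cofinite, SatakeFrobCompatibleAt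 ι π.1 ρ v) → ∀ (ℓ : ℕ) [Fact ℓ.Prime] (ι : PadicAlgCl ℓ ≃+* ℂ) (ρ : Literature.NumberTheory.GaloisRepresentations.FramedGaloisRep K (PadicAlgCl ℓ) n), ℓ < 2 * (n + 1) → ¬ ℓ ∣ n → ¬ (n = 2 ∧ ℓ = 3) → (ρ.restrictField (CyclotomicField ℓ K)).IsResiduallyAbsIrreducible → ¬ (∃ τ : Field.absoluteGaloisGroup (CyclotomicField ℓ K) →* Matrix.GeneralLinearGroup (Fin n) (Literature.NumberTheory.GaloisRepresentations.padicAlgClResidueField ℓ), (ρ.restrictField (CyclotomicField ℓ K)).IsReductionOf (RingHom.id (Literature.NumberTheory.GaloisRepresentations.padicAlgClResidueField ℓ)) τ ∧ Literature.NumberTheory.GaloisRepresentations.IsAbsIrreducible τ ∧ Literature.NumberTheory.GaloisRepresentations.Subgroup.IsThorneAdequate τ.range) → ¬ (∃ τ : Field.absoluteGaloisGroup (CyclotomicField ℓ K) →* Matrix.GeneralLinearGroup (Fin n) (Literature.NumberTheory.GaloisRepresentations.padicAlgClResidueField ℓ), (ρ.restrictField (CyclotomicField ℓ K)).IsReductionOf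 (RingHom.id (Literature.NumberTheory.GaloisRepresentations.padicAlgClResidueField ℓ)) τ ∧ Literature.NumberTheory.GaloisRepresentations.IsAbsIrreducible τ ∧ ∃ P J : Subgroup (Matrix.GeneralLinearGroup (Fin n) (Literature.NumberTheory.GaloisRepresentations.padicAlgClResidueField ℓ)), (P ≤ τ.range ∧ ⁅P, P⁆ = P ∧ ∀ Q : Subgroup (Matrix.GeneralLinearGroup (Fin n) (Literature.NumberTheory.GaloisRepresentations.padicAlgClResidueField ℓ)), Q ≤ τ.range → ⁅Q, Q⁆ = Q → Q ≤ P) ∧ P ≤ J ∧ J ≤ τ.range ∧ Literature.NumberTheory.GaloisRepresentations.IsAbsIrreducible J.subtype ∧ Literature.NumberTheory.GaloisRepresentations.Subgroup.IsThorneAdequate J) → ¬ (∃ (E : Type) (_ : Field E) (_ : NumberField E) (_ : Algebra K E), IsGalois K E ∧ IsSolvable (E ≃ₐ[K] E) ∧ ∃ (m : ℕ) (ϑ : Literature.NumberTheory.GaloisRepresentations.FramedGaloisRep E (PadicAlgCl ℓ) m), m < n ∧ 0 < m ∧ ϑ.toGaloisRep.IsIrreducible ∧ ((∀ᶠ v :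 IsDedekindDomain.HeightOneSpectrum (NumberField.RingOfIntegers E) in cofinite, ϑ.IsUnramifiedAt v) ∧ ∀ (v : IsDedekindDomain.HeightOneSpectrum (NumberField.RingOfIntegers E)) (hv : ((ℓ : ℕ) : NumberField.RingOfIntegers E) ∈ v.asIdeal), (Literature.NumberTheory.PAdicHodge.fontainePstAdicCompletion v ℓ hv).IsDeRhamFramed (ϑ.toLocal v)) ∧ (∃ (mc : ℕ) (θc : Literature.NumberTheory.GaloisRepresentations.FramedGaloisRep E (PadicAlgCl ℓ) mc), ∀ g : Field.absoluteGaloisGroup E, Literature.NumberTheory.GaloisRepresentations.FramedRep.trace (ρ.restrictField E) g = Literature.NumberTheory.GaloisRepresentations.FramedRep.trace ϑ g + Literature.NumberTheory.GaloisRepresentations.FramedRep.trace θc g)) → ¬ ((∃ (S : Finset (IsDedekindDomain.HeightOneSpectrum (NumberField.RingOfIntegers K))) (Q : IsDedekindDomain.HeightOneSpectrum (NumberField.RingOfIntegers K) → Polynomial ℂ) (I : Finset ℤ) (L : Set ℕ) (r : ∀ (ℓ' : ℕ) [Fact ℓ'.Prime], (PadicAlgCl ℓ' ≃+* ℂ)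 → Literature.NumberTheory.GaloisRepresentations.FramedGaloisRep K (PadicAlgCl ℓ') n), ((∃ E : Subfield ℂ, FiniteDimensional ℚ E ∧ ∀ v : IsDedekindDomain.HeightOneSpectrum (NumberField.RingOfIntegers K), v ∉ S → ∀ i : ℕ, (Q v).coeff i ∈ E) ∧ Literature.NumberTheory.LFunctions.HasDirichletDensity L 1 ∧ ∀ (ℓ' : ℕ) [Fact ℓ'.Prime], ℓ' ∈ L → ∀ ι' : PadicAlgCl ℓ' ≃+* ℂ, (r ℓ' ι').toGaloisRep.IsIrreducible ∧ (∀ᶠ v : IsDedekindDomain.HeightOneSpectrum (NumberField.RingOfIntegers K) in cofinite, (r ℓ' ι').IsUnramifiedAt v) ∧ (∀ v : IsDedekindDomain.HeightOneSpectrum (NumberField.RingOfIntegers K), v ∉ S → ((ℓ' : ℕ) : NumberField.RingOfIntegers K) ∉ v.asIdeal → (r ℓ' ι').IsUnramifiedAt v ∧ (r ℓ' ι').HasFrobCharpolyAt v ((Q v).map (ι'.symm : ℂ ≃+* PadicAlgCl ℓ').toRingHom)) ∧ ∀ (v : IsDedekindDomain.HeightOneSpectrum (NumberField.RingOfIntegers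 K)) (hv : ((ℓ' : ℕ) : NumberField.RingOfIntegers K) ∈ v.asIdeal), (Literature.NumberTheory.PAdicHodge.fontainePstAdicCompletion v ℓ' hv).IsDeRhamFramed ((r ℓ' ι').toLocal v) ∧ (v ∉ S → (Literature.NumberTheory.PAdicHodge.fontainePstAdicCompletion v ℓ' hv).IsCrystallineFramed ((r ℓ' ι').toLocal v) ∧ letI := (Literature.NumberTheory.PAdicHodge.fontainePstAdicCompletion v ℓ' hv).algebra; ∀ τ : v.adicCompletion K →ₐ[ℚ_[ℓ']] PadicAlgCl ℓ', ∀ h ∈ (r ℓ' ι').labelledHodgeTateWeightsAt v (Literature.NumberTheory.PAdicHodge.fontainePstAdicCompletion v ℓ' hv).algebra (Literature.NumberTheory.PAdicHodge.fontainePstAdicCompletion v ℓ' hv).𝔅 τ.toRingHom, h ∈ I)) ∧ ∀ v : IsDedekindDomain.HeightOneSpectrum (NumberField.RingOfIntegers K), v ∉ S → ((ℓ : ℕ) : NumberField.RingOfIntegers K) ∉ v.asIdeal → ρ.IsUnramifiedAt v ∧ ρ.HasFrobCharpolyAt v ((Q v).map (ι.symm : ℂ ≃+* PadicAlgCl ℓ).toRingHom))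 ∨ ∃ (N : Type) (_ : Field N) (_ : NumberField N) (_ : Algebra K N) (M : Type) (_ : Field M) (_ : NumberField M) (_ : Algebra K M) (_ : Algebra M N) (_ : IsScalarTower K M N), IsGalois K N ∧ IsSolvable (N ≃ₐ[K] N) ∧ (ρ.restrictField M).toGaloisRep.IsIrreducible ∧ ∃ (S : Finset (IsDedekindDomain.HeightOneSpectrum (NumberField.RingOfIntegers M))) (Q : IsDedekindDomain.HeightOneSpectrum (NumberField.RingOfIntegers M) → Polynomial ℂ) (I : Finset ℤ) (L : Set ℕ) (r : ∀ (ℓ' : ℕ) [Fact ℓ'.Prime], (PadicAlgCl ℓ' ≃+* ℂ) → Literature.NumberTheory.GaloisRepresentations.FramedGaloisRep M (PadicAlgCl ℓ') n), ((∃ E : Subfield ℂ, FiniteDimensional ℚ E ∧ ∀ v : IsDedekindDomain.HeightOneSpectrum (NumberField.RingOfIntegers M), v ∉ S → ∀ i : ℕ, (Q v).coeff i ∈ E) ∧ Literature.NumberTheory.LFunctions.HasDirichletDensity L 1 ∧ ∀ (ℓ' : ℕ) [Fact ℓ'.Prime], ℓ' ∈ L → ∀ ι' : PadicAlgCl ℓ'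 ≃+* ℂ, (r ℓ' ι').toGaloisRep.IsIrreducible ∧ (∀ᶠ v : IsDedekindDomain.HeightOneSpectrum (NumberField.RingOfIntegers M) in cofinite, (r ℓ' ι').IsUnramifiedAt v) ∧ (∀ v : IsDedekindDomain.HeightOneSpectrum (NumberField.RingOfIntegers M), v ∉ S → ((ℓ' : ℕ) : NumberField.RingOfIntegers M) ∉ v.asIdeal → (r ℓ' ι').IsUnramifiedAt v ∧ (r ℓ' ι').HasFrobCharpolyAt v ((Q v).map (ι'.symm : ℂ ≃+* PadicAlgCl ℓ').toRingHom)) ∧ ∀ (v : IsDedekindDomain.HeightOneSpectrum (NumberField.RingOfIntegers M)) (hv : ((ℓ' : ℕ) : NumberField.RingOfIntegers M) ∈ v.asIdeal), (Literature.NumberTheory.PAdicHodge.fontainePstAdicCompletion v ℓ' hv).IsDeRhamFramed ((r ℓ' ι').toLocal v) ∧ (v ∉ S → (Literature.NumberTheory.PAdicHodge.fontainePstAdicCompletion v ℓ' hv).IsCrystallineFramed ((r ℓ' ι').toLocal v) ∧ letI := (Literature.NumberTheory.PAdicHodge.fontainePstAdicCompletion v ℓ' hv).algebra; ∀ τ :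 v.adicCompletion M →ₐ[ℚ_[ℓ']] PadicAlgCl ℓ', ∀ h ∈ (r ℓ' ι').labelledHodgeTateWeightsAt v (Literature.NumberTheory.PAdicHodge.fontainePstAdicCompletion v ℓ' hv).algebra (Literature.NumberTheory.PAdicHodge.fontainePstAdicCompletion v ℓ' hv).𝔅 τ.toRingHom, h ∈ I)) ∧ ∀ v : IsDedekindDomain.HeightOneSpectrum (NumberField.RingOfIntegers M), v ∉ S → ((ℓ : ℕ) : NumberField.RingOfIntegers M) ∉ v.asIdeal → (ρ.restrictField M).IsUnramifiedAt v ∧ (ρ.restrictField M).HasFrobCharpolyAt v ((Q v).map (ι.symm : ℂ ≃+* PadicAlgCl ℓ).toRingHom)) → ρ.toGaloisRep.IsIrreducible → ((∀ᶠ v : IsDedekindDomain.HeightOneSpectrum (NumberField.RingOfIntegers K) in cofinite, ρ.IsUnramifiedAt v) ∧ ∀ (v : IsDedekindDomain.HeightOneSpectrum (NumberField.RingOfIntegers K)) (hv : ((ℓ : ℕ) : NumberField.RingOfIntegers K) ∈ v.asIdeal), (Literature.NumberTheory.PAdicHodge.fontainePstAdicCompletion v ℓ hv).IsDeRhamFramed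 (ρ.toLocal v)) → (∃ (π : Literature.NumberTheory.Automorphic.CuspidalAutomorphicRepData n K hcpt) (ρ' : Literature.NumberTheory.GaloisRepresentations.FramedGaloisRep K (PadicAlgCl ℓ) n), π.1.IsLAlgebraic ∧ ρ'.toGaloisRep.IsIrreducible ∧ (∀ᶠ v : IsDedekindDomain.HeightOneSpectrum (NumberField.RingOfIntegers K) in cofinite, SatakeFrobCompatibleAt ι π.1 ρ' v) ∧ ∀ᶠ v : IsDedekindDomain.HeightOneSpectrum (NumberField.RingOfIntegers K) in cofinite, ∃ P P' : Polynomial (Valued.v : Valuation (PadicAlgCl ℓ) NNReal).valuationSubring, ρ.HasFrobCharpolyAt v (P.map (Valued.v : Valuation (PadicAlgCl ℓ) NNReal).valuationSubring.subtype) ∧ ρ'.HasFrobCharpolyAt v (P'.map (Valued.v : Valuation (PadicAlgCl ℓ) NNReal).valuationSubring.subtype) ∧ P.map (IsLocalRing.residue (Valued.v : Valuation (PadicAlgCl ℓ) NNReal).valuationSubring) = P'.map (IsLocalRing.residue (Valued.v : Valuation (PadicAlgCl ℓ) NNReal).valuationSubring)) → ∃ π : Literature.NumberTheory.Automorphic.CuspidalAutomorphicRepData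 n K hcpt, π.1.IsLAlgebraic ∧ ∀ᶠ v : IsDedekindDomain.HeightOneSpectrum (NumberField.RingOfIntegers K) in cofinite, SatakeFrobCompatibleAt ι π.1 ρ v :=
  stub_coprimeTableLifting_of_noAdequateLayerLifting (LieDefect.rsl_of_cells' ⟨hL, ExtAdequacy.deg_of_cells hH hX hCRD hC, hB⟩)

/-- **TABLE ⟸ LIE ∧ DSH ∧ HIGH ∧ XS ∧ CORE ∧ T_N(+ its seven antecedents)** — the same with the bridge cell CRD discharged by the landed transport
`ExtAdequacy.crd_of_transport` from the items of record OW, RES, W⁺, CSD (parent route) and RPO, RNO₂, RNO₃ (host route), all BY NAME. -/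
theorem stub_coprimeTableLifting_of_leaves_transport (hL : LieDefect.LieObstructedLifting) (hB : LieDefect.DescentShadowLifting)
    (hH : ExtAdequacy.GenericPrimeDegenerateLifting) (hX : ExtAdequacy.ExtendedAdequateLayerLifting) (hC : ExtAdequacy.CoreIrreducibleInadequateLifting)
    (hTn : ExtAdequacy.CoreReducibleTransport) (hOW : LieDefectSplit.OdlyzkoWorldAutomorphy) (hRES : LieDefectSplit.TransOdlyzkoAutomorphy)
    (hW : LieDefectSplit.SatakeAvatarExistence) (hDown : LieDefectSplit.CliffordSolvableDescent) (hPO : OdlyzkoWorldSplit.CyclotomicReducibleOrdinaryLifting)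
    (hR2 : OdlyzkoWorldSplit.CyclotomicReducibleNonOrdinaryRankTwoLifting) (hR3 : OdlyzkoWorldSplit.CyclotomicReducibleNonOrdinaryHigherRankLifting) :
    ∀ (K : Type) [Field K] [NumberField K] (n : ℕ) (hcpt : Literature.NumberTheory.Automorphic.isCompact_glFiniteIntegralLevel n K), 0 < n →
      LiftBelow n → ∀ (ℓ : ℕ) [Fact ℓ.Prime] (ι : PadicAlgCl ℓ ≃+* ℂ) (ρ : FramedGaloisRep K (PadicAlgCl ℓ) n),
        ℓ < 2 * (n + 1) → ¬ ℓ ∣ n → ¬ (n = 2 ∧ ℓ = 3) → CycIrr ρ → ¬ AdequateCyclotomicImage ρ → ¬ SolvablyAdequateImage ρ →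
          ¬ Theorems.BrightMate.SolvablyReducible ρ → ¬ Theorems.BrightMate.SolvablyMated ι ρ → LiftTail K n hcpt ℓ ι ρ :=
  stub_coprimeTableLifting_of_leaves hL hB hH hX (ExtAdequacy.crd_of_transport hTn hOW hRES hW hDown hPO hR2 hR3) hC

/-! ## §2 The landed profile of a TABLE instance -/

/-- **TABLE INSTANCE PROFILE** (parts 1, 2, 4 in one statement).  For a coprime-row instance of RSL — `0 < n`, `ℓ < 2(n+1)`, `ℓ ∤ n`,
`(n, ℓ) ≠ (2, 3)`, `CycIrr ρ`, no adequate image (¬ADQ) and no adequate layer (¬SADQ):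
(1) `2 ≤ n` (the rank-one row is empty); (2) `n = 2 → ℓ = 5`; (3) ¬SXADQ (no EXTENDED-adequate layer either) and (4) no absolutely irreducible
reduction has extended-adequate image (the literal hypothesis of Thorne's 2017 lifting theorem fails too); (5) there is an absolutely irreducible
reduction `τ` of `ρ|Γ_{K(ζ_ℓ)}` with FINITE image `I` of order divisible by `ℓ`, every absolutely irreducible layer `perfectCore I ≤ J ≤ I` of which
has `ℓ ∣ |J|` and is adequate in neither the 2012 nor the extended sense. -/
theorem table_instance_profile {K : Type} [Field K] [NumberField K] {ℓ : ℕ} [Fact ℓ.Prime] {n : ℕ} (hn : 0 < n) (hlt : ℓ < 2 * (n + 1))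
    (hℓn : ¬ ℓ ∣ n) (h23 : ¬ (n = 2 ∧ ℓ = 3)) {ρ : FramedGaloisRep K (PadicAlgCl ℓ) n} (hc : CycIrr ρ) (hA : ¬ AdequateCyclotomicImage ρ)
    (hN : ¬ SolvablyAdequateImage ρ) :
    2 ≤ n ∧ (n = 2 → ℓ = 5) ∧ ¬ ExtAdequacy.SolvablyExtAdequateImage ρ ∧
      (¬ ∃ τ : Field.absoluteGaloisGroup (CyclotomicField ℓ K) →* GL (Fin n) (padicAlgClResidueField ℓ),
        (ρ.restrictField (CyclotomicField ℓ K)).IsReductionOf (RingHom.id _) τ ∧ IsAbsIrreducible τ ∧ Subgroup.IsExtendedAdequate τ.range) ∧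
      ∃ τ : Field.absoluteGaloisGroup (CyclotomicField ℓ K) →* GL (Fin n) (padicAlgClResidueField ℓ),
        (ρ.restrictField (CyclotomicField ℓ K)).IsReductionOf (RingHom.id _) τ ∧ IsAbsIrreducible τ ∧ Finite τ.range ∧ ℓ ∣ Nat.card τ.range ∧
          ∀ J : Subgroup (GL (Fin n) (padicAlgClResidueField ℓ)), perfectCore τ.range ≤ J → J ≤ τ.range → IsAbsIrreducible J.subtype →
            ℓ ∣ Nat.card J ∧ ¬ Subgroup.IsThorneAdequate J ∧ ¬ Subgroup.IsExtendedAdequate J := by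
  haveI : IsAlgClosed (padicAlgClResidueField ℓ) := Literature.RingTheory.Valuation.isAlgClosed_residueField (padicAlgClIntegers ℓ)
  have hne1 : n ≠ 1 := fun h1 => rank_one_row_vacuous h1 hc hN
  refine ⟨by omega, fun h2 => ?_, not_solvablyExtAdequateImage_of_coprime_row hℓn hN, ((table_dials_iff_extended hℓn ρ).1 ⟨hA, hN⟩).1, ?_⟩
  · subst h2
    exact prime_eq_five_of_rank_two_row (Fact.out : ℓ.Prime) hlt hℓn h23
  · obtain ⟨τ, hτ, hirr⟩ := hc
    refine ⟨τ, hτ, hirr, finite_range_of_isReductionOf hτ, dvd_card_image_of_coprime_row hℓn hN hτ hirr, fun J hPJ hJI hJirr => ?_⟩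
    have hnot : ¬ Subgroup.IsThorneAdequate J := fun hadq =>
      hN ((solvablyAdequateImage_iff ρ).2 ⟨τ, hτ, hirr, perfectCore τ.range, J, isPerfectCore_perfectCore τ.range, hPJ, hJI, hJirr, hadq⟩)
    exact ⟨dvd_card_layer_of_coprime_row hℓn hN hτ hirr hPJ hJI hJirr, hnot,
      fun hX => hnot (isThorneAdequate_of_isExtendedAdequate (natCast_ne_zero_of_not_dvd hℓn) hX)⟩

end Summit.Langlands.Langlands.Theorems.CoreAdequacy.CoprimeTable
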